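import Summits.NavierStokesRegularity.NavierStokesRegularity.Theorems.PoloidalWindowDoorPoloidalWindowRigidityZShockObliqueProfile
import Summits.NavierStokesRegularity.NavierStokesRegularity.Theorems.PoloidalWindowDoorPoloidalWindowRigidityZShockMonotoneExtension
import HarnessLib

/-!
# Crux K2 `PoloidalWindowRigidity` (stmt-NavierStokesRegularity-19708), line `z_shock` — RANGE-LOCAL R2 / R2½: the two-sided Liouville
# theorems with the structure function given ON THE COMPACT VALUE HULL ONLY

`--supports stmt-NavierStokesRegularity-19708 --as helper` (leafhand-ns-poloidalwindowdoor-3 g8, cell decomp-ns, 2026-08-31).  Class-free,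
def-free, Mathlib + tree files only.  **No stub and no summit is closed by this file; Navier–Stokes regularity is NOT proved here (rung 0).**

WHY THIS FILE.  The tree's rungs R2 (`…ZShockPSystemNonuniformConst.pSystem_const_nonuniform`, p823120; scalar currency
`…ZShockScalarWaveLiouville.scalarWave_const_nonuniform`, p828185) and R2½ (`…ZShockObliqueProfile.obliqueProfile_const_of_supersonic`,
p828301) take the structure function (`κ`, resp. the squared speed `γ`) on ALL of `ℝ`, with global positivity, global `κ' ≥ 0` and genuine
nonlinearity on every interval of `ℝ`.  The class only supplies it on the values taken by the slice (analytic slope function AT the values,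
`…ZShockHeightEvolution.heightEvolution_of_class_autonomy`; compact value intervals with uniform constants on cones, `…ZShockConeValues`), and
the tree's smooth cutoff `…ZShockSlopeSmoothCutoff` does not preserve sign / monotonicity / genuine nonlinearity.  Standing repair census of
the crux (hand 3-g7, 2026-08-31T16:46Z): «range-local R2/R2½ (extension of κ off the value range) [M]».  With the GN-preserving extension
`…ZShockMonotoneExtension.exists_monotone_gn_extension` this file restates the three theorems with EVERY hypothesis on the structure function
imposed on the compact value hull `[A, B] ⊇ range` only:

* `scalarWave_const_rangeLocal` — ★ R2, scalar currency: a two-sided `C²` solution of `w_zz = ∂ₓ(κ(w)² w_x)` on `ℝ × ℝ` with values in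
  `[A, B]`, `w_x, w_z` bounded, `κ` differentiable on `[A, B]` with continuous derivative, `κ ≥ κlo > 0`, `0 ≤ κ' ≤ k₁`, `κ'` not identically
  zero on any open subinterval of `[A, B]`, is constant;
* `pSystem_const_rangeLocal` — the same for the p-system `p_z = −κ(w)² w_x`, `w_z = −p_x`;
* `obliqueProfile_const_of_supersonic_rangeLocal` — ★ R2½: supersonic oblique travelling profiles `∂₀(γ(Φ)∂₀Φ) = ∂₁((κ₀² − γ(Φ))∂₁Φ)`
  with values in `[A, B]`, `0 < γlo ≤ γ < κ₀²`, `0 ≤ γ' ≤ g₁`, `γ'` not identically zero on open subintervals — all on `[A, B]` — are constant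
  (the extension parameter `δ = min(γlo/2, (κ₀² − γ(B))/2)` keeps the extended speed uniformly supersonic).

The one-signed-`κ'`/`γ'` hypothesis (thick column with `G''` of one sign on the hull) is kept; the `κ' ≤ 0` mirror versions follow from the
tree's `_antitone` theorems in the same way and are not restated.  [folklore] (Lax 1964 / John 1974 two-sided, via the tree.)
-/

noncomputable section

namespace Summit.NavierStokesRegularity.NavierStokesRegularity.Theorems.PoloidalWindowDoorPoloidalWindowRigidityZShockRangeLocal

-- the summit and its single sub-problem share the name (CONVENTIONS §1)
set_option linter.dupNamespace false

open Set Filter Topology Function intervalIntegral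
open Summit.NavierStokesRegularity.NavierStokesRegularity.Theorems.PoloidalWindowDoorPoloidalWindowRigidityZShockPSystemNonuniformConst
open Summit.NavierStokesRegularity.NavierStokesRegularity.Theorems.PoloidalWindowDoorPoloidalWindowRigidityZShockScalarWaveLiouville
open Summit.NavierStokesRegularity.NavierStokesRegularity.Theorems.PoloidalWindowDoorPoloidalWindowRigidityZShockObliqueProfile
open Summit.NavierStokesRegularity.NavierStokesRegularity.Theorems.PoloidalWindowDoorPoloidalWindowRigidityZShockMonotoneExtension

/-! ### From the analytic category of the class to the genuine-nonlinearity hypothesis -/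

/-- **Identity principle on the value hull.**  A function analytic at every point of `[A, B]` which vanishes on some open subinterval
`(a, b) ⊆ [A, B]` vanishes on all of `[A, B]`; contrapositively, if it is nonzero somewhere on `[A, B]` it is nonzero somewhere in EVERY
open subinterval — the `hgn` hypothesis of the range-local theorems below, in the analytic category delivered by the class
(`…ZShockHeightEvolution.heightEvolution_of_class_autonomy`: the slope function is analytic AT the values). [folklore] -/
theorem gn_of_analyticOnNhd {f : ℝ → ℝ} {A B : ℝ} (hf : AnalyticOnNhd ℝ f (Icc A B)) (hne : ∃ v ∈ Icc A B, f v ≠ 0) :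
    ∀ a b : ℝ, A ≤ a → a < b → b ≤ B → ∃ v ∈ Ioo a b, f v ≠ 0 := by
  intro a b ha hab hb
  by_contra h
  push Not at h
  obtain ⟨v₀, hv₀, hfv₀⟩ := hne
  set c : ℝ := (a + b) / 2 with hc_def
  have hc : c ∈ Ioo a b := ⟨by rw [hc_def]; linarith, by rw [hc_def]; linarith⟩
  have hcI : c ∈ Icc A B := ⟨ha.trans hc.1.le, hc.2.le.trans hb⟩
  have hev : f =ᶠ[𝓝 c] 0 :=
    Filter.eventuallyEq_of_mem (Ioo_mem_nhds hc.1 hc.2) fun v hv => h v hv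
  have hzero : EqOn f 0 (Icc A B) :=
    hf.eqOn_zero_of_preconnected_of_eventuallyEq_zero isPreconnected_Icc hcI hev
  exact hfv₀ (hzero hv₀)

/-- **Genuine nonlinearity from analyticity and non-constancy.**  If `κ` is analytic at every point of `[A, B]` and `κ A ≠ κ B`, then
`deriv κ` is nonzero somewhere in every open subinterval of `[A, B]` (mean value theorem + identity principle for the analytic function
`deriv κ`).  With `deriv κ ≥ 0` this is exactly «`κ` strictly increasing on the hull, degeneration of `κ'` only on a finite set». [folklore] -/
theorem gn_deriv_of_analyticOnNhd {κ : ℝ → ℝ} {A B : ℝ} (hκ : AnalyticOnNhd ℝ κ (Icc A B)) (hne : κ A ≠ κ B) :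
    ∀ a b : ℝ, A ≤ a → a < b → b ≤ B → ∃ v ∈ Ioo a b, deriv κ v ≠ 0 := by
  rcases lt_or_ge A B with hAB | hBA
  · have hd : AnalyticOnNhd ℝ (deriv κ) (Icc A B) := fun v hv => (hκ v hv).deriv
    refine gn_of_analyticOnNhd hd ?_
    -- a point with nonzero derivative exists by the mean value theorem
    have hcont : ContinuousOn κ (Icc A B) := fun v hv => (hκ v hv).continuousAt.continuousWithinAt
    have hdiff : DifferentiableOn ℝ κ (Ioo A B) := fun v hv =>
      (hκ v (Ioo_subset_Icc_self hv)).differentiableAt.differentiableWithinAt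
    obtain ⟨c, hc, hcd⟩ := exists_deriv_eq_slope κ hAB hcont hdiff
    refine ⟨c, Ioo_subset_Icc_self hc, ?_⟩
    rw [hcd]
    exact div_ne_zero (sub_ne_zero.2 hne.symm) (sub_ne_zero.2 hAB.ne')
  · -- degenerate hull: the conclusion is vacuous
    intro a b ha hab hb
    exfalso
    linarith

/-! ### Range-local R2 (scalar currency and p-system) -/

/-- ★ **R2, scalar currency, RANGE-LOCAL.**  Let `w : ℝ × ℝ → ℝ` be a two-sided `C²` solution of `∂_z∂_z w = ∂ₓ(κ(w)² ∂ₓw)` (height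
`z` = first coordinate) with VALUES IN `[A, B]` and `w_x`, `w_z` bounded.  Suppose the speed `κ` is known on `[A, B]` only: differentiable there
with derivative `κ'` continuous on `[A, B]`, `κ ≥ κlo > 0`, `0 ≤ κ' ≤ k₁` on `[A, B]`, and `κ'` not identically zero on any open subinterval
of `[A, B]` (genuine nonlinearity may degenerate on a nowhere dense set of values).  Then `w` is constant.  Proof: extend `κ` off the hull by
`exists_monotone_gn_extension`, take a `C²` primitive, and apply the tree's `scalarWave_const_nonuniform`; the equation and all bounds along
the solution only see `κ` on `[A, B]`. [folklore] -/
theorem scalarWave_const_rangeLocal {w : ℝ × ℝ → ℝ} {κ κ' : ℝ → ℝ} {A B κlo k₁ W₁ W₂ : ℝ}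
    (hw : ContDiff ℝ 2 w) (hrange : ∀ q, w q ∈ Icc A B)
    (hκd : ∀ v ∈ Icc A B, HasDerivAt κ (κ' v) v) (hκ'c : ContinuousOn κ' (Icc A B))
    (hpde : ∀ q : ℝ × ℝ, fderiv ℝ (fun q' => fderiv ℝ w q' (1, 0)) q (1, 0) =
      fderiv ℝ (fun q' => κ (w q') ^ 2 * fderiv ℝ w q' (0, 1)) q (0, 1))
    (hκlo0 : 0 < κlo) (hκlo : ∀ v ∈ Icc A B, κlo ≤ κ v)
    (hgnl : ∀ v ∈ Icc A B, 0 ≤ κ' v) (hgn : ∀ a b : ℝ, A ≤ a → a < b → b ≤ B → ∃ v ∈ Ioo a b, κ' v ≠ 0)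
    (hk₁ : ∀ v ∈ Icc A B, |κ' v| ≤ k₁)
    (hW₁ : ∀ q, |fderiv ℝ w q (0, 1)| ≤ W₁) (hW₂ : ∀ q, |fderiv ℝ w q (1, 0)| ≤ W₂) :
    ∀ q q' : ℝ × ℝ, w q = w q' := by
  have hAB : A ≤ B := (hrange 0).1.trans (hrange 0).2
  have hA : A ∈ Icc A B := ⟨le_rfl, hAB⟩
  have hS : ∀ v ∈ Icc A B, κ' v ≤ k₁ := fun v hv => (le_abs_self _).trans (hk₁ v hv)
  obtain ⟨κe, κe', hκe_on, hκe'_on, hκed, hκe'c, hκe'0, hκe'S, hκe_gn, -, hκe_lo, hκe_hi⟩ :=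
    exists_monotone_gn_extension hAB (half_pos hκlo0) hκd hκ'c hgnl hS hgn
  obtain ⟨K, hK2, hKd⟩ := exists_contDiff_two_primitive hκed hκe'c
  have hfun : (fun q' => κe (w q') ^ 2 * fderiv ℝ w q' (0, 1)) = fun q' => κ (w q') ^ 2 * fderiv ℝ w q' (0, 1) :=
    funext fun q' => by rw [hκe_on _ (hrange q')]
  have hpde' : ∀ q : ℝ × ℝ, fderiv ℝ (fun q' => fderiv ℝ w q' (1, 0)) q (1, 0) =
      fderiv ℝ (fun q' => κe (w q') ^ 2 * fderiv ℝ w q' (0, 1)) q (0, 1) := fun q => by rw [hfun]; exact hpde q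
  have hκA : κlo ≤ κ A := hκlo A hA
  exact scalarWave_const_nonuniform (κ := κe) (κ' := κe') (K := K) (κlo := κlo) (κhi := κ B + κlo / 2) (k₁ := k₁ + κlo / 2)
    (W₁ := W₁) (W₂ := W₂) (Mw := max |A| |B|) hw hK2 hKd hκed hκe'c hpde' hκlo0
    (fun q => by rw [hκe_on _ (hrange q)]; exact hκlo _ (hrange q)) (fun q => hκe_hi _)
    (fun v => by linarith [hκe_lo v]) hκe'0 hκe_gn
    (fun q => by rw [hκe'_on _ (hrange q)]; linarith [hk₁ _ (hrange q)]) hW₁ hW₂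
    (fun q => abs_le_max_abs_abs (hrange q).1 (hrange q).2)

/-- ★ **R2, p-system, RANGE-LOCAL.**  The same for a two-sided `C²` solution `(w, p)` of the autonomous p-system `p_z = −κ(w)² w_x`,
`w_z = −p_x` on `ℝ × ℝ` with `w`-values in `[A, B]`: with `κ` as in `scalarWave_const_rangeLocal` (data on `[A, B]` only), `(w, p)` is a
constant state.  (Via the tree's `pSystem_const_nonuniform`.) [folklore] -/
theorem pSystem_const_rangeLocal {w p : ℝ × ℝ → ℝ} {κ κ' : ℝ → ℝ} {A B κlo k₁ W₁ W₂ : ℝ}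
    (hw : ContDiff ℝ 2 w) (hp : ContDiff ℝ 2 p) (hrange : ∀ q, w q ∈ Icc A B)
    (hκd : ∀ v ∈ Icc A B, HasDerivAt κ (κ' v) v) (hκ'c : ContinuousOn κ' (Icc A B))
    (hsys1 : ∀ q, fderiv ℝ p q (1, 0) = -(κ (w q) ^ 2 * fderiv ℝ w q (0, 1)))
    (hsys2 : ∀ q, fderiv ℝ w q (1, 0) = -fderiv ℝ p q (0, 1))
    (hκlo0 : 0 < κlo) (hκlo : ∀ v ∈ Icc A B, κlo ≤ κ v)
    (hgnl : ∀ v ∈ Icc A B, 0 ≤ κ' v) (hgn : ∀ a b : ℝ, A ≤ a → a < b → b ≤ B → ∃ v ∈ Ioo a b, κ' v ≠ 0)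
    (hk₁ : ∀ v ∈ Icc A B, |κ' v| ≤ k₁)
    (hW₁ : ∀ q, |fderiv ℝ w q (0, 1)| ≤ W₁) (hW₂ : ∀ q, |fderiv ℝ w q (1, 0)| ≤ W₂) :
    ∀ q q' : ℝ × ℝ, w q = w q' ∧ p q = p q' := by
  have hAB : A ≤ B := (hrange 0).1.trans (hrange 0).2
  have hA : A ∈ Icc A B := ⟨le_rfl, hAB⟩
  have hS : ∀ v ∈ Icc A B, κ' v ≤ k₁ := fun v hv => (le_abs_self _).trans (hk₁ v hv)
  obtain ⟨κe, κe', hκe_on, hκe'_on, hκed, hκe'c, hκe'0, hκe'S, hκe_gn, -, hκe_lo, hκe_hi⟩ :=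
    exists_monotone_gn_extension hAB (half_pos hκlo0) hκd hκ'c hgnl hS hgn
  obtain ⟨K, hK2, hKd⟩ := exists_contDiff_two_primitive hκed hκe'c
  have hsys1' : ∀ q, fderiv ℝ p q (1, 0) = -(κe (w q) ^ 2 * fderiv ℝ w q (0, 1)) := fun q => by
    rw [hκe_on _ (hrange q)]; exact hsys1 q
  have hκA : κlo ≤ κ A := hκlo A hA
  exact pSystem_const_nonuniform (κ := κe) (κ' := κe') (K := K) (κlo := κlo) (κhi := κ B + κlo / 2) (k₁ := k₁ + κlo / 2)
    (W₁ := W₁) (W₂ := W₂) (Mw := max |A| |B|) hw hp hK2 hKd hκed hκe'c hsys1' hsys2 hκlo0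
    (fun q => by rw [hκe_on _ (hrange q)]; exact hκlo _ (hrange q)) (fun q => hκe_hi _)
    (fun v => by linarith [hκe_lo v]) hκe'0 hκe_gn
    (fun q => by rw [hκe'_on _ (hrange q)]; linarith [hk₁ _ (hrange q)]) hW₁ hW₂
    (fun q => abs_le_max_abs_abs (hrange q).1 (hrange q).2)

/-! ### Range-local R2½ (supersonic oblique travelling profiles) -/

/-- ★ **R2½ RANGE-LOCAL: supersonic oblique profiles with data on the value hull only.**  Let `Φ : ℝ × ℝ → ℝ` be a `C²` profile with
VALUES IN `[A, B]` and `∂₀Φ`, `∂₁Φ` bounded, solving `∂₀(γ(Φ)∂₀Φ) = ∂₁((κ₀² − γ(Φ))∂₁Φ)` on all of `ℝ × ℝ`.  Suppose the squared speed `γ`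
is known on `[A, B]` only: differentiable there with derivative `γ'` continuous on `[A, B]`, `γ ≥ γlo > 0` and `γ < κ₀²` on `[A, B]`
(uniformly supersonic drift on the values taken — automatic from pointwise supersonicity by compactness), `0 ≤ γ' ≤ g₁` on `[A, B]`, `γ'` not
identically zero on any open subinterval of `[A, B]`.  Then `Φ` is constant.  Proof: GN-preserving extension with
`δ = min(γlo/2, (κ₀² − γ(B))/2)` (keeps the extension uniformly supersonic), `C²` primitive, tree `obliqueProfile_const_of_supersonic`.
[folklore] -/
theorem obliqueProfile_const_of_supersonic_rangeLocal {Φ : ℝ × ℝ → ℝ} {γ γ' : ℝ → ℝ} {A B κ₀ γlo g₁ Φ₁ Φ₂ : ℝ}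
    (hΦ : ContDiff ℝ 2 Φ) (hrange : ∀ q, Φ q ∈ Icc A B)
    (hγd : ∀ r ∈ Icc A B, HasDerivAt γ (γ' r) r) (hγ'c : ContinuousOn γ' (Icc A B))
    (hpde : ∀ q : ℝ × ℝ, fderiv ℝ (fun q' => γ (Φ q') * fderiv ℝ Φ q' (1, 0)) q (1, 0) =
      fderiv ℝ (fun q' => (κ₀ ^ 2 - γ (Φ q')) * fderiv ℝ Φ q' (0, 1)) q (0, 1))
    (hγlo0 : 0 < γlo) (hγlo : ∀ r ∈ Icc A B, γlo ≤ γ r) (hsuper : ∀ r ∈ Icc A B, γ r < κ₀ ^ 2)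
    (hgnl : ∀ r ∈ Icc A B, 0 ≤ γ' r) (hgn : ∀ a b : ℝ, A ≤ a → a < b → b ≤ B → ∃ r ∈ Ioo a b, γ' r ≠ 0)
    (hg₁ : ∀ r ∈ Icc A B, |γ' r| ≤ g₁)
    (hΦ₁ : ∀ q, |fderiv ℝ Φ q (0, 1)| ≤ Φ₁) (hΦ₂ : ∀ q, |fderiv ℝ Φ q (1, 0)| ≤ Φ₂) :
    ∀ q q' : ℝ × ℝ, Φ q = Φ q' := by
  have hAB : A ≤ B := (hrange 0).1.trans (hrange 0).2
  have hA : A ∈ Icc A B := ⟨le_rfl, hAB⟩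
  have hB : B ∈ Icc A B := ⟨hAB, le_rfl⟩
  have hS : ∀ r ∈ Icc A B, γ' r ≤ g₁ := fun r hr => (le_abs_self _).trans (hg₁ r hr)
  have hγB : γ B < κ₀ ^ 2 := hsuper B hB
  set δ : ℝ := min (γlo / 2) ((κ₀ ^ 2 - γ B) / 2) with hδ_def
  have hδ : 0 < δ := lt_min (half_pos hγlo0) (by linarith)
  have hδ1 : δ ≤ γlo / 2 := min_le_left _ _
  have hδ2 : δ ≤ (κ₀ ^ 2 - γ B) / 2 := min_le_right _ _
  obtain ⟨γe, γe', hγe_on, hγe'_on, hγed, hγe'c, hγe'0, hγe'S, hγe_gn, -, hγe_lo, hγe_hi⟩ :=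
    exists_monotone_gn_extension hAB hδ hγd hγ'c hgnl hS hgn
  obtain ⟨Γ, hΓ2, hΓd⟩ := exists_contDiff_two_primitive hγed hγe'c
  have hfun1 : (fun q' => γe (Φ q') * fderiv ℝ Φ q' (1, 0)) = fun q' => γ (Φ q') * fderiv ℝ Φ q' (1, 0) :=
    funext fun q' => by rw [hγe_on _ (hrange q')]
  have hfun2 : (fun q' => (κ₀ ^ 2 - γe (Φ q')) * fderiv ℝ Φ q' (0, 1)) = fun q' => (κ₀ ^ 2 - γ (Φ q')) * fderiv ℝ Φ q' (0, 1) :=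
    funext fun q' => by rw [hγe_on _ (hrange q')]
  have hpde' : ∀ q : ℝ × ℝ, fderiv ℝ (fun q' => γe (Φ q') * fderiv ℝ Φ q' (1, 0)) q (1, 0) =
      fderiv ℝ (fun q' => (κ₀ ^ 2 - γe (Φ q')) * fderiv ℝ Φ q' (0, 1)) q (0, 1) := fun q => by
    rw [hfun1, hfun2]; exact hpde q
  have hγA : γlo ≤ γ A := hγlo A hA
  exact obliqueProfile_const_of_supersonic (γ := γe) (γ' := γe') (Γ := Γ) (γlo := γlo / 2) (γhi := γ B + δ) (g₁ := g₁ + δ)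
    (Φ₁ := Φ₁) (Φ₂ := Φ₂) (MΦ := max |A| |B|) hΦ hΓ2 hΓd hγed hγe'c hpde' (half_pos hγlo0)
    (fun r => by linarith [hγe_lo r]) (fun r => hγe_hi r) (by linarith) hγe'0 hγe_gn
    (fun r => by rw [abs_of_nonneg (hγe'0 r)]; exact hγe'S r) hΦ₁ hΦ₂
    (fun q => abs_le_max_abs_abs (hrange q).1 (hrange q).2)

end Summit.NavierStokesRegularity.NavierStokesRegularity.Theorems.PoloidalWindowDoorPoloidalWindowRigidityZShockRangeLocal

end
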